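import Summits.Ventures.Crystal3D.Theorems.StickyWulffConstantTextureBuildLedgerClip
import HarnessLib

/-!
# TB-D assembly, part 7c: LEDGER SPLITTING, WALL HALF — cross-grain contacts are special (cut / curtain), free (zero weight), or charged to designated regions
# (lane T, crux `TextureLiminfV5`, stmt-Ventures-23912; repair census HOME/wulff-p2/g20/TB-D-1-g20.md §2 (d)(e), §4 brick B10)

HONEST FRAMING. Venture `Summits/Ventures/Crystal3D` (cell `crystal3d-full`), route `route-Ventures-StickyWulffConstant`, helper `--supports` the
law-v5 crux `TextureLiminfV5` (stmt-Ventures-23912).  Pure continuum bookkeeping (census-free, standard axioms) for the `PieceData` construction behind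
`stub_TB_energy`: the WALL line of the piece ledger (`energy_le_pieceLedger`, …TextureBuildPieceEnergy) is bounded from a CLASSIFICATION of contacts.
Nothing about any cover or mesh; F-C1 not moved.

SETTING.  Pieces `P μ = polytope (Hp μ)` (bounded, unit normals, distinct facet planes, pairwise disjoint), classes `cls μ`, wall weights `w ℓ ℓ' ν ≥ 0`
(`≤ κc/2` on unit vectors; intended `w = c/2 · h_{wallBody m}`), designated planar regions `Φ d ⊆ {⟪nrm d, x⟫ = lvl d}` (closed, bounded, unit `nrm d`), and
a predicate `Sp μ μ' p` of SPECIAL contacts (the cut polygons and the riser curtains, whose cost the caller bounds by `chargeSum` / `riserSum`).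
The contact of the facet `p` of `μ` with `μ'` is `C μ p μ' := cl P μ ∩ {⟪p.1,x⟫ = p.2} ∩ cl P μ'`.
HYPOTHESIS (P2).  For `cls μ' ≠ cls μ` and `p ∈ Hp μ`: the contact is special, OR its weight vanishes, OR it lies — up to a `facetArea`-null set — in the
designated regions carried by the facet's plane with EITHER orientation (`(nrm d, lvl d) = p`: own side designated; `(−nrm d, −lvl d) = p`: far side).
CONCLUSION (`wall_le_split`).  `Σ_μ Σ_{cls μ' ≠ cls μ} Σ_{p} w·facetArea (C μ p μ') ≤ Σ (special terms) + κc · Σ_d facetArea (Φ d) (nrm d)`.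
PROOF.  Per contact, (P2) and a finite cover give `term ≤ [special term] + (κc/2)·Σ_{d : ±match} facetArea (C ∩ Φ d)`; re-indexed by `d`, the own-side
sum is `Σ_μ Σ_{μ'} facetArea (C μ (nrm d, lvl d) μ' ∩ Φ d) ≤ Σ_μ facetArea (cl P μ ∩ Φ d) ≤ facetArea (Φ d)` by CONTACT ADDITIVITY FROM BOTH SIDES
(`sum_facetArea_contact_le`, part 7a) and one-side additivity (`sum_facetArea_inter_le_of_sameSide`, p711205); the far-side sum likewise with the normal
`−nrm d` (`facetArea_neg`).  Two designated sums, each `≤ Σ_d facetArea (Φ d)`, times `κc/2`.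
-/

noncomputable section

namespace Summit.Ventures.Crystal3D.Cruxes.TextureLiminf.TexShadow

open Summit.Ventures.Crystal3D Summit.Ventures.Crystal3D.Theorems MeasureTheory Set
open scoped InnerProductSpace

/-- Summing over a filter of a disjunction is at most the two filtered sums (nonnegative terms). -/
theorem sum_filter_or_le' {ι : Type*} (s : Finset ι) (P Q : ι → Prop) [DecidablePred P] [DecidablePred Q] (f : ι → ℝ)
    (hf : ∀ i ∈ s, 0 ≤ f i) :
    ∑ i ∈ s.filter (fun i => P i ∨ Q i), f i ≤ ∑ i ∈ s.filter P, f i + ∑ i ∈ s.filter Q, f i := by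
  classical
  rw [Finset.filter_or]
  calc ∑ i ∈ s.filter P ∪ s.filter Q, f i
      ≤ ∑ i ∈ s.filter P ∪ s.filter Q, f i + ∑ i ∈ s.filter P ∩ s.filter Q, f i :=
        le_add_of_nonneg_right (Finset.sum_nonneg fun i hi => hf i (Finset.mem_of_mem_filter _ (Finset.mem_of_mem_inter_left hi)))
    _ = ∑ i ∈ s.filter P, f i + ∑ i ∈ s.filter Q, f i := Finset.sum_union_inter

/-- Re-indexing a double sum over (facet `p`, designated `d` with `q d = p`) by `d`. -/
theorem sum_sum_filter_eq_reindex {ι : Type*} [DecidableEq ι] (H : Finset (E3 × ℝ)) (dS : Finset ι) (q : ι → E3 × ℝ) (G : (E3 × ℝ) → ι → ℝ) :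
    ∑ p ∈ H, ∑ d ∈ dS.filter (fun d => q d = p), G p d = ∑ d ∈ dS, (if q d ∈ H then G (q d) d else 0) := by
  classical
  rw [Finset.sum_comm' (t' := dS) (s' := fun d => H.filter (fun p => p = q d))]
  · refine Finset.sum_congr rfl fun d _ => ?_
    rw [Finset.filter_eq']
    split_ifs <;> simp
  · intro p d
    simp only [Finset.mem_filter]
    constructor
    · rintro ⟨hp, hd, h⟩; exact ⟨⟨hp, h.symm⟩, hd⟩
    · rintro ⟨⟨hp, h⟩, hd⟩; exact ⟨hp, hd, h.symm⟩

/-- **LEDGER SPLITTING, WALL HALF.**  See the module docstring. -/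
theorem wall_le_split {n M : ℕ} (w : Fin n → Fin n → E3 → ℝ) (hw0 : ∀ ℓ ℓ' ν, 0 ≤ w ℓ ℓ' ν) {κc : ℝ} (hκc : 0 ≤ κc)
    (hw : ∀ ℓ ℓ' (ν : E3), ‖ν‖ = 1 → w ℓ ℓ' ν ≤ κc / 2)
    (Hp : Fin M → Finset (E3 × ℝ)) (cls : Fin M → Fin n)
    (hbd : ∀ μ, Bornology.IsBounded (polytope (Hp μ)))
    (hunit : ∀ μ, ∀ p ∈ Hp μ, ‖p.1‖ = 1)
    (hplanes : ∀ μ, ∀ p ∈ Hp μ, ∀ p' ∈ Hp μ, p ≠ p' →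
      {x : E3 | ⟪p.1, x⟫_ℝ = p.2} ≠ {x : E3 | ⟪p'.1, x⟫_ℝ = p'.2})
    (hdisj : ∀ μ μ', μ ≠ μ' → Disjoint (polytope (Hp μ)) (polytope (Hp μ')))
    {ι : Type*} [DecidableEq ι] (dS : Finset ι) (Φ : ι → Set E3) (nrm : ι → E3) (lvl : ι → ℝ)
    (hΦ : ∀ d ∈ dS, Φ d ⊆ {x : E3 | ⟪nrm d, x⟫_ℝ = lvl d}) (hnrm : ∀ d ∈ dS, ‖nrm d‖ = 1)
    (hΦc : ∀ d ∈ dS, IsClosed (Φ d)) (hΦb : ∀ d ∈ dS, Bornology.IsBounded (Φ d))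
    (Sp : Fin M → Fin M → E3 × ℝ → Prop) [∀ μ μ' p, Decidable (Sp μ μ' p)]
    (hP2 : ∀ μ μ', cls μ' ≠ cls μ → ∀ p ∈ Hp μ, Sp μ μ' p ∨ w (cls μ) (cls μ') p.1 = 0 ∨
      facetArea ((closure (polytope (Hp μ)) ∩ {x : E3 | ⟪p.1, x⟫_ℝ = p.2} ∩ closure (polytope (Hp μ'))) \
        ⋃ d ∈ dS.filter (fun d => (nrm d, lvl d) = p ∨ (-nrm d, -lvl d) = p), Φ d) p.1 = 0) :
    (∑ μ, ∑ μ' ∈ Finset.univ.filter (fun μ' => cls μ' ≠ cls μ), ∑ p ∈ Hp μ, w (cls μ) (cls μ') p.1 *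
        facetArea (closure (polytope (Hp μ)) ∩ {x : E3 | ⟪p.1, x⟫_ℝ = p.2} ∩ closure (polytope (Hp μ'))) p.1) ≤
      (∑ μ, ∑ μ' ∈ Finset.univ.filter (fun μ' => cls μ' ≠ cls μ), ∑ p ∈ (Hp μ).filter (fun p => Sp μ μ' p), w (cls μ) (cls μ') p.1 *
        facetArea (closure (polytope (Hp μ)) ∩ {x : E3 | ⟪p.1, x⟫_ℝ = p.2} ∩ closure (polytope (Hp μ'))) p.1) +
      κc * ∑ d ∈ dS, facetArea (Φ d) (nrm d) := by
  classical
  set C : Fin M → (E3 × ℝ) → Fin M → Set E3 := fun μ p μ' =>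
    closure (polytope (Hp μ)) ∩ {x : E3 | ⟪p.1, x⟫_ℝ = p.2} ∩ closure (polytope (Hp μ')) with hC
  have hCsub : ∀ μ p μ', C μ p μ' ⊆ closure (polytope (Hp μ)) := fun μ p μ' x hx => hx.1.1
  have hfa0 : ∀ (S : Set E3) (ν : E3), 0 ≤ facetArea S ν := fun _ _ => ENNReal.toReal_nonneg
  set Dpm : (E3 × ℝ) → Finset ι := fun p => dS.filter (fun d => (nrm d, lvl d) = p ∨ (-nrm d, -lvl d) = p) with hDpm
  -- STEP 1: per contact
  have hstep1 : ∀ μ, ∀ μ' ∈ Finset.univ.filter (fun μ' => cls μ' ≠ cls μ), ∀ p ∈ Hp μ,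
      w (cls μ) (cls μ') p.1 * facetArea (C μ p μ') p.1 ≤
        (if Sp μ μ' p then w (cls μ) (cls μ') p.1 * facetArea (C μ p μ') p.1 else 0) +
          κc / 2 * ∑ d ∈ Dpm p, facetArea (C μ p μ' ∩ Φ d) p.1 := by
    intro μ μ' hμ' p hp
    have hne : cls μ' ≠ cls μ := (Finset.mem_filter.1 hμ').2
    have hnn : 0 ≤ κc / 2 * ∑ d ∈ Dpm p, facetArea (C μ p μ' ∩ Φ d) p.1 :=
      mul_nonneg (by linarith) (Finset.sum_nonneg fun d _ => hfa0 _ _)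
    rcases hP2 μ μ' hne p hp with hsp | hzero | hnull
    · rw [if_pos hsp]; linarith
    · rw [hzero, zero_mul]
      split_ifs <;> linarith
    · -- finite cover of the contact by the matching designated regions and the null rest
      have hcover : facetArea (C μ p μ') p.1 ≤ ∑ d ∈ Dpm p, facetArea (C μ p μ' ∩ Φ d) p.1 + 0 := by
        set G : Option ι → Set E3 := fun o => match o with
          | none => C μ p μ' \ ⋃ d ∈ Dpm p, Φ d
          | some d => C μ p μ' ∩ Φ d with hG
        have hcov : C μ p μ' ⊆ ⋃ o ∈ insert none ((Dpm p).image some), G o := by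
          intro x hx
          by_cases hxD : x ∈ ⋃ d ∈ Dpm p, Φ d
          · obtain ⟨d, hd, hxd⟩ := mem_iUnion₂.1 hxD
            exact mem_iUnion₂.2 ⟨some d, Finset.mem_insert_of_mem (Finset.mem_image_of_mem _ hd), hx, hxd⟩
          · exact mem_iUnion₂.2 ⟨none, Finset.mem_insert_self _ _, hx, hxD⟩
        have hfin : ∀ o ∈ insert none ((Dpm p).image some), volume {x : E3 | ∃ y ∈ G o, ∃ t ∈ Set.Icc (0 : ℝ) 1, x = y + t • p.1} ≠ ⊤ := by
          intro o _
          rcases o with _ | d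
          · exact volume_prism_ne_top_of_isBounded (hbd μ) _ (fun x hx => hCsub μ p μ' hx.1) p.1
          · exact volume_prism_ne_top_of_isBounded (hbd μ) _ (fun x hx => hCsub μ p μ' hx.1) p.1
        have h1 := facetArea_le_sum_of_subset_iUnion (insert none ((Dpm p).image some)) (C μ p μ') G p.1 hcov hfin
        have hnotmem : none ∉ (Dpm p).image some := by simp
        rw [Finset.sum_insert hnotmem, Finset.sum_image (fun d _ d' _ h => Option.some_injective _ h)] at h1
        have hnone : facetArea (G none) p.1 = 0 := hnull
        have hsome : ∑ d ∈ Dpm p, facetArea (G (some d)) p.1 = ∑ d ∈ Dpm p, facetArea (C μ p μ' ∩ Φ d) p.1 := rfl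
        linarith
      have hwle : w (cls μ) (cls μ') p.1 ≤ κc / 2 := hw _ _ _ (hunit μ p hp)
      have hT : w (cls μ) (cls μ') p.1 * facetArea (C μ p μ') p.1 ≤ κc / 2 * ∑ d ∈ Dpm p, facetArea (C μ p μ' ∩ Φ d) p.1 :=
        calc w (cls μ) (cls μ') p.1 * facetArea (C μ p μ') p.1
            ≤ w (cls μ) (cls μ') p.1 * (∑ d ∈ Dpm p, facetArea (C μ p μ' ∩ Φ d) p.1 + 0) :=
              mul_le_mul_of_nonneg_left hcover (hw0 _ _ _)
          _ ≤ κc / 2 * (∑ d ∈ Dpm p, facetArea (C μ p μ' ∩ Φ d) p.1 + 0) :=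
              mul_le_mul_of_nonneg_right hwle (by linarith [Finset.sum_nonneg fun d (_ : d ∈ Dpm p) => hfa0 (C μ p μ' ∩ Φ d) p.1])
          _ = κc / 2 * ∑ d ∈ Dpm p, facetArea (C μ p μ' ∩ Φ d) p.1 := by rw [add_zero]
      have hif : 0 ≤ (if Sp μ μ' p then w (cls μ) (cls μ') p.1 * facetArea (C μ p μ') p.1 else 0) := by
        split_ifs
        · exact mul_nonneg (hw0 _ _ _) (hfa0 _ _)
        · exact le_rfl
      linarith
  -- STEP 2: sum the per-contact bounds
  have hstep2 : (∑ μ, ∑ μ' ∈ Finset.univ.filter (fun μ' => cls μ' ≠ cls μ), ∑ p ∈ Hp μ, w (cls μ) (cls μ') p.1 * facetArea (C μ p μ') p.1) ≤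
      (∑ μ, ∑ μ' ∈ Finset.univ.filter (fun μ' => cls μ' ≠ cls μ), ∑ p ∈ (Hp μ).filter (fun p => Sp μ μ' p),
          w (cls μ) (cls μ') p.1 * facetArea (C μ p μ') p.1) +
      κc / 2 * ∑ μ, ∑ μ' ∈ Finset.univ.filter (fun μ' => cls μ' ≠ cls μ), ∑ p ∈ Hp μ, ∑ d ∈ Dpm p, facetArea (C μ p μ' ∩ Φ d) p.1 := by
    rw [Finset.mul_sum, ← Finset.sum_add_distrib]
    refine Finset.sum_le_sum fun μ _ => ?_
    rw [Finset.mul_sum, ← Finset.sum_add_distrib]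
    refine Finset.sum_le_sum fun μ' hμ' => ?_
    rw [Finset.sum_filter, Finset.mul_sum, ← Finset.sum_add_distrib]
    exact Finset.sum_le_sum fun p hp => hstep1 μ μ' hμ' p hp
  -- STEP 3: the designated quadruple sum is at most twice the designated area
  have hstep3 : (∑ μ, ∑ μ' ∈ Finset.univ.filter (fun μ' => cls μ' ≠ cls μ), ∑ p ∈ Hp μ, ∑ d ∈ Dpm p, facetArea (C μ p μ' ∩ Φ d) p.1) ≤
      2 * ∑ d ∈ dS, facetArea (Φ d) (nrm d) := by
    -- swap `μ'` inside: Σ_μ Σ_p Σ_d Σ_μ'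
    have hswap : ∀ μ, (∑ μ' ∈ Finset.univ.filter (fun μ' => cls μ' ≠ cls μ), ∑ p ∈ Hp μ, ∑ d ∈ Dpm p, facetArea (C μ p μ' ∩ Φ d) p.1) =
        ∑ p ∈ Hp μ, ∑ d ∈ Dpm p, ∑ μ' ∈ Finset.univ.filter (fun μ' => cls μ' ≠ cls μ), facetArea (C μ p μ' ∩ Φ d) p.1 := by
      intro μ
      rw [Finset.sum_comm]
      exact Finset.sum_congr rfl fun p _ => Finset.sum_comm
    simp only [hswap]
    -- the inner `μ'`-sum is a contact sum from both sides: ≤ facetArea (cl P μ ∩ Φ d)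
    have hinner : ∀ μ, ∀ p ∈ Hp μ, ∀ d ∈ Dpm p,
        (∑ μ' ∈ Finset.univ.filter (fun μ' => cls μ' ≠ cls μ), facetArea (C μ p μ' ∩ Φ d) p.1) ≤
          facetArea (closure (polytope (Hp μ)) ∩ Φ d) p.1 := by
      intro μ p hp d hd
      have hd' : d ∈ dS := Finset.mem_of_mem_filter _ hd
      have hplane : closure (polytope (Hp μ)) ∩ Φ d ⊆ {x : E3 | ⟪p.1, x⟫_ℝ = p.2} := by
        intro x hx
        have hx' := hΦ d hd' hx.2
        simp only [mem_setOf_eq] at hx' ⊢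
        rcases (Finset.mem_filter.1 hd).2 with h | h
        · rw [← h]; exact hx'
        · rw [← h]; simp only [inner_neg_left, hx']
      have hle : (∑ μ' ∈ Finset.univ.filter (fun μ' => cls μ' ≠ cls μ), facetArea (C μ p μ' ∩ Φ d) p.1) ≤
          ∑ μ' ∈ Finset.univ.erase μ, facetArea (closure (polytope (Hp μ)) ∩ {x : E3 | ⟪p.1, x⟫_ℝ = p.2} ∩
            closure (polytope (Hp μ')) ∩ (closure (polytope (Hp μ)) ∩ Φ d)) p.1 := by
        have hsub : Finset.univ.filter (fun μ' => cls μ' ≠ cls μ) ⊆ Finset.univ.erase μ := by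
          intro μ' hμ'
          exact Finset.mem_erase.2 ⟨fun h => (Finset.mem_filter.1 hμ').2 (by rw [h]), Finset.mem_univ _⟩
        have heq : ∀ μ', C μ p μ' ∩ Φ d = closure (polytope (Hp μ)) ∩ {x : E3 | ⟪p.1, x⟫_ℝ = p.2} ∩
            closure (polytope (Hp μ')) ∩ (closure (polytope (Hp μ)) ∩ Φ d) := by
          intro μ'
          ext x
          simp only [hC, mem_inter_iff, mem_setOf_eq]
          tauto
        simp only [heq]
        exact Finset.sum_le_sum_of_subset_of_nonneg hsub fun μ' _ _ => hfa0 _ _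
      refine hle.trans ?_
      exact sum_facetArea_contact_le Finset.univ Hp (fun μ _ μ' _ hne => hdisj μ μ' hne) (Finset.mem_univ μ) (hbd μ) (hunit μ)
        (hplanes μ) hp hplane (isClosed_closure.inter (hΦc d hd')) ((hΦb d hd').subset inter_subset_right)
    have hmid : (∑ μ, ∑ p ∈ Hp μ, ∑ d ∈ Dpm p, ∑ μ' ∈ Finset.univ.filter (fun μ' => cls μ' ≠ cls μ), facetArea (C μ p μ' ∩ Φ d) p.1) ≤
        ∑ μ, ∑ p ∈ Hp μ, ∑ d ∈ Dpm p, facetArea (closure (polytope (Hp μ)) ∩ Φ d) p.1 :=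
      Finset.sum_le_sum fun μ _ => Finset.sum_le_sum fun p hp => Finset.sum_le_sum fun d hd => hinner μ p hp d hd
    refine hmid.trans ?_
    -- split `Dpm` into the two orientations
    have hsplit : ∀ μ, ∀ p ∈ Hp μ, (∑ d ∈ Dpm p, facetArea (closure (polytope (Hp μ)) ∩ Φ d) p.1) ≤
        (∑ d ∈ dS.filter (fun d => (nrm d, lvl d) = p), facetArea (closure (polytope (Hp μ)) ∩ Φ d) p.1) +
          ∑ d ∈ dS.filter (fun d => (-nrm d, -lvl d) = p), facetArea (closure (polytope (Hp μ)) ∩ Φ d) p.1 :=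
      fun μ p _ => sum_filter_or_le' dS _ _ _ fun d _ => hfa0 _ _
    have hsplit' : (∑ μ, ∑ p ∈ Hp μ, ∑ d ∈ Dpm p, facetArea (closure (polytope (Hp μ)) ∩ Φ d) p.1) ≤
        (∑ μ, ∑ p ∈ Hp μ, ∑ d ∈ dS.filter (fun d => (nrm d, lvl d) = p), facetArea (closure (polytope (Hp μ)) ∩ Φ d) p.1) +
          ∑ μ, ∑ p ∈ Hp μ, ∑ d ∈ dS.filter (fun d => (-nrm d, -lvl d) = p), facetArea (closure (polytope (Hp μ)) ∩ Φ d) p.1 := by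
      rw [← Finset.sum_add_distrib]
      refine Finset.sum_le_sum fun μ _ => ?_
      rw [← Finset.sum_add_distrib]
      exact Finset.sum_le_sum fun p hp => hsplit μ p hp
    refine hsplit'.trans ?_
    -- own side: re-index by `d`, then one-side additivity with the normal `nrm d`
    have hplus : (∑ μ, ∑ p ∈ Hp μ, ∑ d ∈ dS.filter (fun d => (nrm d, lvl d) = p), facetArea (closure (polytope (Hp μ)) ∩ Φ d) p.1) ≤
        ∑ d ∈ dS, facetArea (Φ d) (nrm d) := by
      have hre : ∀ μ, (∑ p ∈ Hp μ, ∑ d ∈ dS.filter (fun d => (nrm d, lvl d) = p), facetArea (closure (polytope (Hp μ)) ∩ Φ d) p.1) =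
          ∑ d ∈ dS, (if (nrm d, lvl d) ∈ Hp μ then facetArea (closure (polytope (Hp μ)) ∩ Φ d) (nrm d) else 0) := fun μ =>
        sum_sum_filter_eq_reindex (Hp μ) dS (fun d => (nrm d, lvl d)) (fun p d => facetArea (closure (polytope (Hp μ)) ∩ Φ d) p.1)
      simp only [hre]
      rw [Finset.sum_comm]
      refine Finset.sum_le_sum fun d hd => ?_
      rw [← Finset.sum_filter]
      have hs : ∀ μ ∈ Finset.univ.filter (fun μ => (nrm d, lvl d) ∈ Hp μ), polytope (Hp μ) ⊆ {x : E3 | ⟪nrm d, x⟫_ℝ < lvl d} := by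
        intro μ hμ x hx
        have hmem := (Finset.mem_filter.1 hμ).2
        simp only [polytope, mem_iInter, mem_setOf_eq] at hx
        exact hx _ hmem
      exact sum_facetArea_inter_le_of_sameSide (Finset.univ.filter (fun μ => (nrm d, lvl d) ∈ Hp μ)) Hp (hnrm d hd) hs
        (fun μ _ μ' _ hne => hdisj μ μ' hne) (hΦ d hd) (hΦc d hd) (hΦb d hd)
    -- far side: re-index by `d`, then one-side additivity with the normal `−nrm d`, and `facetArea_neg`
    have hminus : (∑ μ, ∑ p ∈ Hp μ, ∑ d ∈ dS.filter (fun d => (-nrm d, -lvl d) = p), facetArea (closure (polytope (Hp μ)) ∩ Φ d) p.1) ≤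
        ∑ d ∈ dS, facetArea (Φ d) (nrm d) := by
      have hre : ∀ μ, (∑ p ∈ Hp μ, ∑ d ∈ dS.filter (fun d => (-nrm d, -lvl d) = p), facetArea (closure (polytope (Hp μ)) ∩ Φ d) p.1) =
          ∑ d ∈ dS, (if (-nrm d, -lvl d) ∈ Hp μ then facetArea (closure (polytope (Hp μ)) ∩ Φ d) (-nrm d) else 0) := fun μ =>
        sum_sum_filter_eq_reindex (Hp μ) dS (fun d => (-nrm d, -lvl d)) (fun p d => facetArea (closure (polytope (Hp μ)) ∩ Φ d) p.1)
      simp only [hre]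
      rw [Finset.sum_comm]
      refine Finset.sum_le_sum fun d hd => ?_
      rw [← Finset.sum_filter, ← facetArea_neg (Φ d) (nrm d)]
      have hs : ∀ μ ∈ Finset.univ.filter (fun μ => (-nrm d, -lvl d) ∈ Hp μ), polytope (Hp μ) ⊆ {x : E3 | ⟪-nrm d, x⟫_ℝ < -lvl d} := by
        intro μ hμ x hx
        have hmem := (Finset.mem_filter.1 hμ).2
        simp only [polytope, mem_iInter, mem_setOf_eq] at hx
        exact hx _ hmem
      have hneg1 : ‖-nrm d‖ = 1 := by rw [norm_neg, hnrm d hd]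
      have hΦneg : Φ d ⊆ {x : E3 | ⟪-nrm d, x⟫_ℝ = -lvl d} := fun x hx => by
        have := hΦ d hd hx; simp only [mem_setOf_eq] at this ⊢; rw [inner_neg_left, this]
      exact sum_facetArea_inter_le_of_sameSide (Finset.univ.filter (fun μ => (-nrm d, -lvl d) ∈ Hp μ)) Hp hneg1 hs
        (fun μ _ μ' _ hne => hdisj μ μ' hne) hΦneg (hΦc d hd) (hΦb d hd)
    linarith
  -- conclusion
  have hκ2 : κc / 2 * (∑ μ, ∑ μ' ∈ Finset.univ.filter (fun μ' => cls μ' ≠ cls μ), ∑ p ∈ Hp μ, ∑ d ∈ Dpm p, facetArea (C μ p μ' ∩ Φ d) p.1) ≤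
      κc * ∑ d ∈ dS, facetArea (Φ d) (nrm d) := by
    have := mul_le_mul_of_nonneg_left hstep3 (show 0 ≤ κc / 2 by linarith)
    linarith
  linarith [hstep2, hκ2]

end Summit.Ventures.Crystal3D.Cruxes.TextureLiminf.TexShadow

end
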